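import Summits.BirchSwinnertonDyer.BirchSwinnertonDyer.Theorems.CorpuzLei2025_sharpFlatMainConjecture_transfer_OPEN
import Summits.BirchSwinnertonDyer.BirchSwinnertonDyer.Theorems.SignedLowerHalvesSprungLowerHalfAtThreeSmallImage
import HarnessLib

/-!
# Route `SignedLowerHalves`, crux `SprungLowerHalfAtThree` (item stmt-BirchSwinnertonDyer-19003) — Fouquet–Wan
# Thm 5.1 (PREPRINT) READ THROUGH Sprung 2012 Prop 7.19 on corner X8: ONE explicitly labelled, X8-scoped OPEN
# hypothesis in the tree's ♯/♭ currency (two tiers: §5 = Thm 5.1, §4.6 = Thm 4.51), and the registered stub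
# `stub_chromaticDivisibility` on X8 ∩ (Fouquet–Wan locus) CLOSED MODULO IT at every analytic rank
# (cell `bsd-ssimc`, seat `bsd-ssimc-k3c5-fw21-locus` gen 0, PART 1b ACCEL row (3); `--supports … --as helper`)

PARTITION (cell bsd-ssimc, D-0054): X8 (A8) ∩ the Fouquet–Wan sub-locus {`E[3]` absolutely irreducible
(automatic on X8), a prime `ℓ ≠ 3` of NON-SPLIT multiplicative reduction with `3 ∤ ord_ℓ(Δ_min)`}, BOTH
ranks — planner census W-bf-9: 121 of the 217 X8 cells of conductor `< 5·10⁵` (rank 0 surj 68, rank 1 surj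
53); class-wide census of the 3 211 S-b X8 pairs in the seat's STATUS line — types-the-object-of; closes
NONE; nothing booked; BSD is not proved by any of this.

HONEST FRAMING. An UNREFEREED preprint enters the tree ONLY as an explicitly labelled OPEN hypothesis
(`@[conjecture] def … : Prop`, an OBLIGATION node; nothing asserted;
consumers take it as a binder) — the pattern of `FouquetWan2021_thm51_via_kobayashi74_OPEN` (lev g5, X7, the
± currency via Kobayashi 2003 Thm 7.4) and of `CorpuzLei2025_sharpFlatMainConjecture_transfer_OPEN`
(k3-c5 g3, X8, the ♯/♭ currency). Crux 5 stays OPEN.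

## Why a THIRD Fouquet–Wan binder, and what it says

The tree carries Fouquet–Wan arXiv:2107.13726 (2021, arXiv only) twice in PRINT SHAPE — Cor 5.4 (rank-0 `p`-part,
`FouquetWan2021.cor54_pPart_rankZero_OPEN`, p412876) and Cor 5.3 (corank-0 converse, `…cor53_finiteSelmer_iff_rankZero_OPEN`,
p420742) — and once in the ± currency (Thm 5.1 ∘ Kobayashi Thm 7.4, `a_p = 0`: NOT on X8). Both corollaries are
deductions (p. 53) from the ONE theorem the preprint proves, Thm 5.1 = Kato's Main Conjecture 12.10 for `M(f)`. At an
odd supersingular prime Kato's conjecture is EQUIVALENT to Sprung's ♯/♭ Main Conjecture 7.21 for every colour `•` with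
`L^•_p ≠ 0` (Sprung, JNT 132 (2012), Prop 7.19 + Prop 7.17, «for all other cases» than `a_p = 0, ♭, η = 𝟙` — so
verbatim at `a_3 = ±3`; p. 1505; PUBLISHED), and Kim's Euler characteristic for `Sel^•` (Sprung, Adv. Math. 449 (2024)
Lemmas 5.5–5.9, PUBLISHED, unconditional) gives the tree's predicate (K•) `SignedDatum.EulerCharacteristic` for its
characteristic power series. `Sel^♯/♭` is NOT tree vocabulary (definition item `defn-SharpFlatSelmerDualData`, ACCEL
row (2)), so — exactly as the crux and the Corpuz–Lei binder do — the main conjecture for colour `•` is stated on the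
BARE datum: `∃ ξ ∈ Λ` with (K•) and `(ξ) = (L^•)` in `Λ`. Two tiers, as the X7 pair (`…X7FouquetWan` §5 /
`…X7FouquetWanCrystalline` §4.6): `FouquetWan2021_thm51_via_sprung719_OPEN` (Thm 5.1, §5: universal-deformation
argument, NO image hypothesis) and `FouquetWan2021_thm451_via_sprung719_OPEN` (Thm 4.51 = Thm 1.13, §4.6: the
crystalline chain, whose proof invokes Kato's INTEGRAL divisibility — Kato's (12.5.2) `Kato2004.ImageContainsSL2 W p`,
displayed); the first implies the second. On X8 ∩ FW locus (12.5.2) is a tree THEOREM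
(`X8_imageContainsSL2_of_semistable_or_fwLocus`, p421044), so the WEAKER §4.6 tier already yields every consumer.

## First-hand audit datum for the point `(p, k, a_p) = (3, 2, ±3)` (this seat, text `paper:arxiv-2107.13726`)

(i) The three bullets of Thm 5.1 (p. 53) hold on X8 ∩ locus: `ρ̄` absolutely irreducible (Serre Prop 12 at the
supersingular `3`; the transvection at the ramified `ℓ` even makes `ρ̄` onto `GL₂(𝔽₃)`, so the Taylor–Wiles condition
of their Assumption 2.1 over `ℚ(√−3)` holds too); `(ρ̄|G_{ℚ_3})^{ss} ≠ χ̄ ⊕ χ̄_cyc χ̄` (irreducible); the `ℓ`-bullet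
with `μ` non-trivial = non-split + `3 ∤ ord_ℓ Δ_min` in their convention `ρ_f = T_3E(−1)`. (ii) `f_E` is ITSELF
«crystalline and short» (p. 13: `2 ≤ k ≤ p`, here `2 ≤ 2 ≤ 3`) with `ρ̄|G_{ℚ_3}` absolutely irreducible, so Thm 1.13
= Thm 4.51 applies to `f_E` directly. (iii) `p = 3` is admitted explicitly (Remark after Thm (TheoNakamura), p. 20,
footnote p. 22: the `p ≥ 5` of [NakamuraUniversal] is lifted via [PaskunasANT]). (iv) `a_3 = ±3` versus `0` plays
no role in the printed crystalline argument (Coleman family through `f_α` of slope `1/2` in both cases; the ± theory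
is avoided, p. 9). (v) Standing cell flags (lev MEMO-5 + addA–D, REPORT-lev-7): the non-ordinary Eisenstein side
(Thm 7.32 over [XinWanIMC], [EischenWan], Wan ANT 2020) at `p = 3` is UNAUDITED; arXiv only. NOT a verification.
What the file proves (theorems only besides the two binders; nothing asserted about any curve):
`X8.sharpFlatMainConjecture_fwLocus_of_thm451_OPEN` / `…thm51…` (Main Conj 7.21 on the locus for every colour with
`L^• ≠ 0`, binder ALONE); `stub_chromaticDivisibility_fwLocus_of_thm51_OPEN` (+ §4.6 twin): the REGISTERED stub (B),
header VERBATIM, restricted to the locus, EVERY analytic rank, modulo {ONE binder, the period unit at 3} — compare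
p418174 (⟸ cor54 + 5 published facts, `r_an ≤ 1`) and p421099 (⟸ cor53 ∧ cor54 + 5 facts): here the colour is
Rohrlich's (`ClassX8.exists_chromaticL_ne_zero`, a THEOREM) and `h` is a unit; `X8.analyticRank_eq_zero_fwLocus_…`
(Cor 5.3's X8 content RECOVERED: `Sel_{3^∞}(E/ℚ)` finite ⇒ `r_an = 0`); `X8.bsdp_fwLocus_…` (Cor 5.4's X8 content
RECOVERED: `r_an = 0` ⇒ `BSD(E,3)`, via the EQUALITY); `X8.missingInputAt_fwLocus_…` (typed currency). So on X8 the
three Fouquet–Wan transcriptions are consistent; the Thm-5.1 binder carries what the two corollary binders carried,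
through PUBLISHED bridges (Sprung 2012 / 2024) instead of the preprint's own corollaries. Records ≠ crux closure.

References: [FouquetWan2021] Thm 5.1 (p. 53), Thm 1.7 (p. 5), Thm 1.13 (p. 8) = Thm 4.51 (p. 50), §2.2.1
(p. 13), Remark p. 20, Cor 5.3/5.4 (p. 53) (PRE); [Sprung2012] Prop 6.14 (p. 1498), Thm 7.14, Thm 7.16,
Prop 7.17, Prop 7.19, Conj 7.20, Main Conj 7.21 (pp. 1504–1505); [Sprung2024] Lemmas 5.5–5.9 (pp. 40–41);
[Sprung2017] Thm 1.12, Cor 4.11; [Kato2004Asterisque] Conj 12.10, (12.5.2); [Wuthrich2014] Lemma 20;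
[Serre1972] Props 12, 15; [GreenbergVatsal2000] Rem 3.4; [Mazur1978] Cor 4.1; [Miller2011LMS] Def 1.1.
-/

set_option autoImplicit false
set_option linter.dupNamespace false

noncomputable section

open scoped Classical MatrixGroups ModularForm

open CongruenceSubgroup WeierstrassCurve Literature.NumberTheory.EllipticCurves
  Literature.NumberTheory.EllipticCurves.ModularForms
  Literature.NumberTheory.EllipticCurves.Sprung2017
  Literature.NumberTheory.EllipticCurves.Rank1Residual
  Literature.NumberTheory.EllipticCurves.Rank1Residual.Typed
  Summit.BirchSwinnertonDyer.Rank1Residual.Supersingular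

namespace Summit.BirchSwinnertonDyer.BirchSwinnertonDyer.Theorems

/-! ### The two tiers of the binder -/
/-- **OPEN HYPOTHESIS — UNREFEREED PREPRINT (Fouquet–Wan, arXiv:2107.13726, 2021), Thm 5.1 (= Thm 1.7),
READ THROUGH Sprung 2012 Prop 7.19 / 7.17 and Sprung 2024 Lemmas 5.5–5.9 (published), scoped to corner X8
and the preprint's locus.** FW Thm 5.1 (p. 53): for `p ≥ 3`, `f ∈ S_k(Γ₀(Np^r))`, `k ≥ 2`, if `ρ̄_f` is
absolutely irreducible, `(ρ̄_f|G_{ℚ_p})^{ss} ≠ χ̄ ⊕ χ̄_cyc χ̄`, and there is `ℓ ∤ p`, `ℓ ∥ N`, with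
`ρ̄_f|G_{ℚ_ℓ}` a RAMIFIED extension of `μχ_cyc^{−k/2}` by `μχ_cyc^{1−k/2}`, `μ` unramified quadratic and
non-trivial when `ρ̄_f|G_{ℚ_p}` is irreducible, then Kato's Main Conjecture (Conj 12.10: equality of
characteristic ideals) holds for `M(f)`. Sprung 2012 Prop 7.19 with Prop 7.17 (p. 1505): at an odd
supersingular prime, Kato's conjecture (his Conj 7.20) is EQUIVALENT to Main Conj 7.21
`Char X^•(E/ℚ_∞) = (L^•_p(E,X))` for every colour `•` with `L^•_p ≠ 0` («for all other cases» than
`♭, η = 𝟙, a_p = 0` — verbatim at `a_3 = ±3`); Sprung 2024 Lemmas 5.5–5.9: Kim's Euler characteristic for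
`Sel^•`. TRANSCRIBED for a globally minimal `W` on corner X8 (`p = 3`, good at `3`, `3 ∣ a_3`, `a_3 ≠ 0`;
then `k = 2 ≤ p`, `ρ̄|G_{ℚ_3}` is irreducible so `μ` must be non-trivial), `E[3]` irreducible (printed;
automatic, Serre Prop 12), a prime `ℓ ≠ 3` of NON-SPLIT multiplicative reduction with `E[3]` ramified at
`ℓ` (`3 ∤ ord_ℓ Δ_min`; FW's convention `ρ_f = T_3E(−1)`): for every newform `f` of `W` (any level), every
Sprung pair `(L♯, L♭)` for `a_3(W)` (`IsSprungPair`, Sprung 2017 Thm 1.12) and every colour `•` with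
`L^• ≠ 0`, there is `ξ ∈ Λ = ℤ₃⟦T⟧` — read: a characteristic power series of `X^•(E/ℚ_∞)`, which is not tree
vocabulary — with the Euler-characteristic property (K•) of the tree's bare X8 datum and `(ξ) = (L^•)` in
`Λ` (the tree's `L^•` is `Ω⁺_f`-normalised; on X8 the Néron/`Ω⁺_f` ratio is a `3`-adic unit, so the ideal is
the same). This is the SAME conclusion shape as `CorpuzLei2025_sharpFlatMainConjecture_transfer_OPEN`.
NEVER cite this `Prop` as a theorem: the FW step is an unrefereed claim (freshness 2026-08-26: arXiv only; its
non-ordinary Eisenstein side rests on [XinWanIMC]/[EischenWan]/Wan ANT 2020, unaudited by the cell at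
`p = 3`; `p = 3` itself is admitted by the Remark p. 20 via [PaskunasANT]); the Sprung steps are published.
Take it as an explicit hypothesis `(hFW : FouquetWan2021_thm51_via_sprung719_OPEN)`. Weaker than the print
(bare datum, X8 scope), never stronger. [claim: FouquetWan2021, status: under-review]
[cite: Sprung2012, Prop. 7.19, Prop. 7.17 and Main Conj. 7.21 (p. 1505)]
[cite: Sprung2024, Lemmas 5.5–5.9 (pp. 40–41)] [cite: Sprung2017, Thm. 1.12] -/
@[conjecture] def FouquetWan2021_thm51_via_sprung719_OPEN : Prop :=
  ∀ (W : WeierstrassCurve ℚ) [W.IsElliptic] [W.IsGloballyMinimal] (p : ℕ) [Fact p.Prime],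
    p = 3 → W.HasGoodReductionAtPrime p → (p : ℤ) ∣ W.frobeniusTrace p → W.frobeniusTrace p ≠ 0 →
    Irr W p →
    (∃ (ℓ : ℕ) (_ : Fact ℓ.Prime), ℓ ≠ p ∧ W.HasMultiplicativeReductionAtPrime ℓ ∧
        ¬ W.HasSplitMultiplicativeReductionAtPrime ℓ ∧ ¬ p ∣ padicValInt ℓ W.minimalDiscriminantInt) →
    ∀ {N : ℕ} [NeZero N] (f : CuspForm (Gamma0 N) 2), IsNewformOf W f →
    ∀ (Lsharp Lflat : IwasawaAlgebra p), IsSprungPair f p (W.frobeniusTrace p) Lsharp Lflat →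
    ∀ (c : Chroma), chromaticL c Lsharp Lflat ≠ 0 →
      ∃ ξ : IwasawaAlgebra p, (⟨ξ, 0, 0⟩ : SignedDatum W p).EulerCharacteristic ∧
        Ideal.span ({ξ} : Set (IwasawaAlgebra p)) = Ideal.span {chromaticL c Lsharp Lflat}

/-- **OPEN HYPOTHESIS — UNREFEREED PREPRINT (Fouquet–Wan, arXiv:2107.13726), Thm 4.51 = Thm 1.13 (§4.6, the
CRYSTALLINE chain), READ THROUGH Sprung 2012 Prop 7.19 / 7.17 and Sprung 2024 Lemmas 5.5–5.9 (published),
scoped to corner X8 and the preprint's locus — the WEAKER tier.** FW Thm 4.51 (p. 50): `f ∈ S_k(Γ₀(N))`,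
`k ≥ 2`, (i) `ρ_f|G_{ℚ_p}` crystalline (`p ∤ N`) and short (`2 ≤ k ≤ p`, p. 13), (ii) `ρ̄_f|G_{ℚ_p}`
absolutely irreducible, (iii) `∃ ℓ ∥ N` with `dim ρ̄^{I_ℓ} = 1`, `dim ρ̄^{G_ℓ} = 0` ⇒ Kato's Main Conjecture
for `M(f)`; its proof (§4.6.3, p. 46) invokes Kato's INTEGRAL divisibility, stated (Thm (TheoKatoIntro), p. 4)
under «the image of `ρ_f|G_{ℚ(ζ_{p^∞})}` contains `SL₂(ℤ_p)`» — a hypothesis the printed statement omits and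
this transcription DISPLAYS as Kato's (12.5.2) `Kato2004.ImageContainsSL2 W p`. For an X8 curve `f_E` IS a
crystalline short point (`k = 2 ≤ 3 = p`) with `ρ̄|G_{ℚ_3}` absolutely irreducible (supersingular), and (iii)
in the convention `ρ_f = T_3E(−1)` reads: a prime `ℓ ≠ 3` of NON-SPLIT multiplicative reduction with `E[3]`
ramified at `ℓ`. Conclusion as in `FouquetWan2021_thm51_via_sprung719_OPEN` (Sprung's Main Conj 7.21 for every
colour with `L^• ≠ 0`, bare-datum form). Implied by the §5 tier (`thm451_sprung_OPEN_of_thm51_sprung_OPEN`);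
on X8 ∩ locus the displayed (12.5.2) is a tree theorem, so this weaker tier already yields every consumer
below. NEVER cite this `Prop` as a theorem. [claim: FouquetWan2021, status: under-review]
[cite: Sprung2012, Prop. 7.19, Prop. 7.17 and Main Conj. 7.21 (p. 1505)]
[cite: Sprung2024, Lemmas 5.5–5.9 (pp. 40–41)] [cite: Kato2004Asterisque, (12.5.2) in Thm. 12.5 (4) (p. 222)] -/
@[conjecture] def FouquetWan2021_thm451_via_sprung719_OPEN : Prop :=
  ∀ (W : WeierstrassCurve ℚ) [W.IsElliptic] [W.IsGloballyMinimal] (p : ℕ) [Fact p.Prime],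
    p = 3 → W.HasGoodReductionAtPrime p → (p : ℤ) ∣ W.frobeniusTrace p → W.frobeniusTrace p ≠ 0 →
    Irr W p → Kato2004.ImageContainsSL2 W p →
    (∃ (ℓ : ℕ) (_ : Fact ℓ.Prime), ℓ ≠ p ∧ W.HasMultiplicativeReductionAtPrime ℓ ∧
        ¬ W.HasSplitMultiplicativeReductionAtPrime ℓ ∧ ¬ p ∣ padicValInt ℓ W.minimalDiscriminantInt) →
    ∀ {N : ℕ} [NeZero N] (f : CuspForm (Gamma0 N) 2), IsNewformOf W f →
    ∀ (Lsharp Lflat : IwasawaAlgebra p), IsSprungPair f p (W.frobeniusTrace p) Lsharp Lflat →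
    ∀ (c : Chroma), chromaticL c Lsharp Lflat ≠ 0 →
      ∃ ξ : IwasawaAlgebra p, (⟨ξ, 0, 0⟩ : SignedDatum W p).EulerCharacteristic ∧
        Ideal.span ({ξ} : Set (IwasawaAlgebra p)) = Ideal.span {chromaticL c Lsharp Lflat}

/-- **The §5 tier implies the §4.6 tier** (the same hypotheses plus Kato's (12.5.2), which is dropped): every
conditional theorem below, stated modulo the §4.6 tier, holds a fortiori modulo the §5 tier. Pure logic.
[claim: FouquetWan2021, status: under-review] -/
theorem thm451_sprung_OPEN_of_thm51_sprung_OPEN (h : FouquetWan2021_thm51_via_sprung719_OPEN) :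
    FouquetWan2021_thm451_via_sprung719_OPEN :=
  fun W _ _ p _ hp hgood hss hne hirr _himg hloc _ _ f hf Lsharp Lflat hSP c hc =>
    h W p hp hgood hss hne hirr hloc f hf Lsharp Lflat hSP c hc

/-! ### Consumers on X8 ∩ (Fouquet–Wan locus) — CONDITIONAL, closing nothing -/

section Consumers

variable (W : WeierstrassCurve ℚ) [W.IsElliptic] [W.IsGloballyMinimal] (p : ℕ) [Fact p.Prime]

/-- **Sprung's Main Conj 7.21 on X8 ∩ (FW locus), for EVERY colour with `L^• ≠ 0`, MODULO the §4.6 tier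
ALONE.** The binder's scope hypotheses are discharged by the class: `p = 3`, good supersingular `3`,
`a_3 ≠ 0` (`ClassX8`), `E[3]` irreducible (`ClassX8.irr'`, Serre Prop 12), and Kato's (12.5.2) by the tree
theorem `X8_imageContainsSL2_of_semistable_or_fwLocus` (transvection at the ramified `ℓ` ⇒ `ρ̄_{E,3}` onto ⇒
`SL₂(ℤ₃)` by Wuthrich 2014 Lemma 20). CONDITIONAL on the PRE binder; nothing asserted about any curve.
[claim: FouquetWan2021, status: under-review] [cite: Sprung2012, Prop. 7.19 and Main Conj. 7.21 (p. 1505)]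
[cite: Wuthrich2014, Lemma 20 (p. 399)] [cite: Serre1972, §1.11 Prop. 12 and §2.4 Prop. 15] -/
theorem X8.sharpFlatMainConjecture_fwLocus_of_thm451_OPEN
    (hFW : FouquetWan2021_thm451_via_sprung719_OPEN) (hX : ClassX8 W p)
    (hloc : ∃ (ℓ : ℕ) (_ : Fact ℓ.Prime), ℓ ≠ p ∧ W.HasMultiplicativeReductionAtPrime ℓ ∧
        ¬ W.HasSplitMultiplicativeReductionAtPrime ℓ ∧ ¬ p ∣ padicValInt ℓ W.minimalDiscriminantInt)
    {N : ℕ} [NeZero N] {f : CuspForm (Gamma0 N) 2} (hf : IsNewformOf W f)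
    {Lsharp Lflat : IwasawaAlgebra p} (hSP : IsSprungPair f p (W.frobeniusTrace p) Lsharp Lflat)
    (c : Chroma) (hc : chromaticL c Lsharp Lflat ≠ 0) :
    ∃ ξ : IwasawaAlgebra p, (⟨ξ, 0, 0⟩ : SignedDatum W p).EulerCharacteristic ∧
      Ideal.span ({ξ} : Set (IwasawaAlgebra p)) = Ideal.span {chromaticL c Lsharp Lflat} := by
  have himg : Kato2004.ImageContainsSL2 W p :=
    (X8_imageContainsSL2_of_semistable_or_fwLocus W p hX (Or.inr hloc)).2
  have hirr : Irr W p := ClassX8.irr' W p hX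
  obtain ⟨hp3, ⟨hgood, hss⟩, hne⟩ := hX
  subst hp3
  exact hFW W 3 rfl hgood hss hne hirr himg hloc f hf Lsharp Lflat hSP c hc

/-- **The same modulo the §5 tier** (Thm 5.1, no image hypothesis in print; here it is discharged anyway).
CONDITIONAL; nothing asserted. [claim: FouquetWan2021, status: under-review]
[cite: Sprung2012, Prop. 7.19 and Main Conj. 7.21 (p. 1505)] -/
theorem X8.sharpFlatMainConjecture_fwLocus_of_thm51_OPEN
    (hFW : FouquetWan2021_thm51_via_sprung719_OPEN) (hX : ClassX8 W p)
    (hloc : ∃ (ℓ : ℕ) (_ : Fact ℓ.Prime), ℓ ≠ p ∧ W.HasMultiplicativeReductionAtPrime ℓ ∧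
        ¬ W.HasSplitMultiplicativeReductionAtPrime ℓ ∧ ¬ p ∣ padicValInt ℓ W.minimalDiscriminantInt)
    {N : ℕ} [NeZero N] {f : CuspForm (Gamma0 N) 2} (hf : IsNewformOf W f)
    {Lsharp Lflat : IwasawaAlgebra p} (hSP : IsSprungPair f p (W.frobeniusTrace p) Lsharp Lflat)
    (c : Chroma) (hc : chromaticL c Lsharp Lflat ≠ 0) :
    ∃ ξ : IwasawaAlgebra p, (⟨ξ, 0, 0⟩ : SignedDatum W p).EulerCharacteristic ∧
      Ideal.span ({ξ} : Set (IwasawaAlgebra p)) = Ideal.span {chromaticL c Lsharp Lflat} :=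
  X8.sharpFlatMainConjecture_fwLocus_of_thm451_OPEN W p (thm451_sprung_OPEN_of_thm51_sprung_OPEN hFW) hX
    hloc hf hSP c hc

/-- **Clause (B) of crux 5 on X8 ∩ (FW locus), ANY analytic rank, for the GIVEN real objects, MODULO the
§4.6 tier and the period unit at `3`.** For the newform `f` of `W`, its period ratio `ϖ` (`ϖ·Ω_E = Ω⁺_f`) and
any Sprung pair: some colour has `L^• ≠ 0` (Rohrlich, `ClassX8.exists_chromaticL_ne_zero` — a THEOREM); the
binder gives `ξ` with (K•) and `(ξ) = (L^•)`; `ϖ` is a `3`-adic unit (`X8_norm_periodRatio_eq_one` from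
`h3` = `realPeriodRat_eq_unit_mul_plusPeriod_three`, Mazur 1978 Cor 4.1 + Greenberg–Vatsal Rem 3.4), so
`ι ξ = ϖ·ι(L^•·h)` with `h` a UNIT of `Λ` (`exists_isUnit_eq_C_mul_of_span_eq`). No GZK, no modularity
supply, no (conv₀)/(low₀) input. CONDITIONAL; closes nothing. [claim: FouquetWan2021, status: under-review]
[cite: Sprung2012, Prop. 6.14 (p. 1498) and Main Conj. 7.21 (p. 1505)]
[cite: GreenbergVatsal2000, §3 Remark 3.4] [cite: Mazur1978, Cor. 4.1] -/
theorem X8.chromaticDivisibility_fwLocus_of_thm451_OPEN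
    (hFW : FouquetWan2021_thm451_via_sprung719_OPEN) (h3 : realPeriodRat_eq_unit_mul_plusPeriod_three)
    (hX : ClassX8 W p)
    (hloc : ∃ (ℓ : ℕ) (_ : Fact ℓ.Prime), ℓ ≠ p ∧ W.HasMultiplicativeReductionAtPrime ℓ ∧
        ¬ W.HasSplitMultiplicativeReductionAtPrime ℓ ∧ ¬ p ∣ padicValInt ℓ W.minimalDiscriminantInt)
    {N : ℕ} [NeZero N] {f : CuspForm (Gamma0 N) 2} (hf : IsNewformOf W f)
    {ϖ : ℚ} (hϖ : (ϖ : ℝ) * W.realPeriodRat = plusPeriod f)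
    {Lsharp Lflat : IwasawaAlgebra p} (hSP : IsSprungPair f p (W.frobeniusTrace p) Lsharp Lflat) :
    ∃ (c : Chroma) (ξ : IwasawaAlgebra p), (⟨ξ, 0, 0⟩ : SignedDatum W p).EulerCharacteristic ∧
      ∃ h : IwasawaAlgebra p, IsUnit h ∧ iwasawaToPowerSeries p ξ =
        PowerSeries.C (ϖ : ℚ_[p]) * iwasawaToPowerSeries p (chromaticL c Lsharp Lflat * h) := by
  obtain ⟨c, hc⟩ := ClassX8.exists_chromaticL_ne_zero W p hX hf hSP
  obtain ⟨ξ, hK, hspan⟩ := X8.sharpFlatMainConjecture_fwLocus_of_thm451_OPEN W p hFW hX hloc hf hSP c hc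
  have hn : ‖(ϖ : ℚ_[p])‖ = 1 := X8_norm_periodRatio_eq_one h3 W p hX hf hϖ
  have hvϖ : padicValRat p ϖ = 0 := padicValRat_eq_zero_of_norm_ratCast_eq_one hn
  have hϖ0 : ϖ ≠ 0 := by
    intro hz
    rw [hz, Rat.cast_zero, norm_zero] at hn
    exact zero_ne_one hn
  obtain ⟨h, hu, hh⟩ := exists_isUnit_eq_C_mul_of_span_eq p hspan hϖ0 hvϖ
  exact ⟨c, ξ, hK, h, hu, hh⟩

/-- **The registered stub `stub_chromaticDivisibility` of `Cruxes/SprungLowerHalfAtThree/Lines/birth.lean`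
(header VERBATIM) restricted to the Fouquet–Wan locus, at EVERY analytic rank, MODULO the ONE §5 binder
(Thm 5.1 read through Sprung Prop 7.19) and the period unit at `3`.** Leading binders: `hFW` (PRE),
`h3` (PUBLISHED support `RealPeriodUnitPlusPeriodThree` of the route); then the stub's own quantifiers with ONE
locus hypothesis inserted after `ClassX8 W p`. Compare the corollary-shaped roads already in the tree: p418174
(⟸ `cor54_pPart_rankZero_OPEN` + 5 published facts, `r_an ≤ 1`) and p421099 (⟸ cor53 ∧ cor54 + 5 published
facts, any rank). What it buys on X8: the 121 locus cells of board A8 (rank 0: 68; rank 1: 53) and,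
class-wide, the locus share of the 3 211 S-b X8 pairs (seat census) would read «PRE-claimed (FW Thm 5.1 ∘
Sprung Prop 7.19)» for crux 5's clause (B). CONDITIONAL; closes nothing; nothing booked.
[claim: FouquetWan2021, status: under-review] [cite: Sprung2012, Prop. 6.14, Prop. 7.19 and Main Conj. 7.21]
[cite: GreenbergVatsal2000, §3 Remark 3.4] [cite: Mazur1978, Cor. 4.1] -/
theorem stub_chromaticDivisibility_fwLocus_of_thm51_OPEN
    (hFW : FouquetWan2021_thm51_via_sprung719_OPEN) (h3 : realPeriodRat_eq_unit_mul_plusPeriod_three) :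
    ∀ (W : WeierstrassCurve ℚ) [W.IsElliptic] [W.IsGloballyMinimal] (p : ℕ) [Fact p.Prime],
      Literature.NumberTheory.EllipticCurves.Rank1Residual.ClassX8 W p →
      (∃ (ℓ : ℕ) (_ : Fact ℓ.Prime), ℓ ≠ p ∧ W.HasMultiplicativeReductionAtPrime ℓ ∧
        ¬ W.HasSplitMultiplicativeReductionAtPrime ℓ ∧ ¬ p ∣ padicValInt ℓ W.minimalDiscriminantInt) →
      ∀ (N : ℕ) (_ : NeZero N) (f : CuspForm (CongruenceSubgroup.Gamma0 N) 2) (ϖ : ℚ)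
        (Lsharp Lflat : Literature.NumberTheory.EllipticCurves.IwasawaAlgebra p),
        Literature.NumberTheory.EllipticCurves.ModularForms.IsNewformOf W f →
        (ϖ : ℝ) * W.realPeriodRat = Literature.NumberTheory.EllipticCurves.ModularForms.plusPeriod f →
        Literature.NumberTheory.EllipticCurves.Sprung2017.IsSprungPair f p (W.frobeniusTrace p)
          Lsharp Lflat →
        ∃ (c : Literature.NumberTheory.EllipticCurves.Sprung2017.Chroma)
          (ξ : Literature.NumberTheory.EllipticCurves.IwasawaAlgebra p),
          (⟨ξ, 0, 0⟩ : Summit.BirchSwinnertonDyer.Rank1Residual.Supersingular.SignedDatum W p).EulerCharacteristic ∧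
          ∃ h : Literature.NumberTheory.EllipticCurves.IwasawaAlgebra p,
            Literature.NumberTheory.EllipticCurves.iwasawaToPowerSeries p ξ =
              PowerSeries.C (ϖ : ℚ_[p]) *
                Literature.NumberTheory.EllipticCurves.iwasawaToPowerSeries p
                  (Literature.NumberTheory.EllipticCurves.Sprung2017.chromaticL c Lsharp Lflat * h) := by
  intro W _ _ p _ hX hloc N hN f ϖ Lsharp Lflat hf hϖ hSP
  obtain ⟨c, ξ, hK, h, -, hh⟩ := X8.chromaticDivisibility_fwLocus_of_thm451_OPEN W p
    (thm451_sprung_OPEN_of_thm51_sprung_OPEN hFW) h3 hX hloc hf hϖ hSP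
  exact ⟨c, ξ, hK, h, hh⟩

/-- **The same stub modulo the WEAKER §4.6 tier** (Thm 4.51 read through Sprung Prop 7.19; its displayed
Kato (12.5.2) is discharged on the locus) and the period unit at `3` — the stronger conditional statement.
CONDITIONAL; closes nothing. [claim: FouquetWan2021, status: under-review]
[cite: Sprung2012, Prop. 6.14, Prop. 7.19 and Main Conj. 7.21] [cite: Wuthrich2014, Lemma 20 (p. 399)] -/
theorem stub_chromaticDivisibility_fwLocus_of_thm451_OPEN
    (hFW : FouquetWan2021_thm451_via_sprung719_OPEN) (h3 : realPeriodRat_eq_unit_mul_plusPeriod_three) :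
    ∀ (W : WeierstrassCurve ℚ) [W.IsElliptic] [W.IsGloballyMinimal] (p : ℕ) [Fact p.Prime],
      Literature.NumberTheory.EllipticCurves.Rank1Residual.ClassX8 W p →
      (∃ (ℓ : ℕ) (_ : Fact ℓ.Prime), ℓ ≠ p ∧ W.HasMultiplicativeReductionAtPrime ℓ ∧
        ¬ W.HasSplitMultiplicativeReductionAtPrime ℓ ∧ ¬ p ∣ padicValInt ℓ W.minimalDiscriminantInt) →
      ∀ (N : ℕ) (_ : NeZero N) (f : CuspForm (CongruenceSubgroup.Gamma0 N) 2) (ϖ : ℚ)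
        (Lsharp Lflat : Literature.NumberTheory.EllipticCurves.IwasawaAlgebra p),
        Literature.NumberTheory.EllipticCurves.ModularForms.IsNewformOf W f →
        (ϖ : ℝ) * W.realPeriodRat = Literature.NumberTheory.EllipticCurves.ModularForms.plusPeriod f →
        Literature.NumberTheory.EllipticCurves.Sprung2017.IsSprungPair f p (W.frobeniusTrace p)
          Lsharp Lflat →
        ∃ (c : Literature.NumberTheory.EllipticCurves.Sprung2017.Chroma)
          (ξ : Literature.NumberTheory.EllipticCurves.IwasawaAlgebra p),
          (⟨ξ, 0, 0⟩ : Summit.BirchSwinnertonDyer.Rank1Residual.Supersingular.SignedDatum W p).EulerCharacteristic ∧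
          ∃ h : Literature.NumberTheory.EllipticCurves.IwasawaAlgebra p,
            Literature.NumberTheory.EllipticCurves.iwasawaToPowerSeries p ξ =
              PowerSeries.C (ϖ : ℚ_[p]) *
                Literature.NumberTheory.EllipticCurves.iwasawaToPowerSeries p
                  (Literature.NumberTheory.EllipticCurves.Sprung2017.chromaticL c Lsharp Lflat * h) := by
  intro W _ _ p _ hX hloc N hN f ϖ Lsharp Lflat hf hϖ hSP
  obtain ⟨c, ξ, hK, h, -, hh⟩ := X8.chromaticDivisibility_fwLocus_of_thm451_OPEN W p hFW h3 hX hloc hf hϖ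
    hSP
  exact ⟨c, ξ, hK, h, hh⟩

/-- **Cor 5.3's X8 content RECOVERED from the one binder: on X8 ∩ (FW locus), `Sel_{3^∞}(E/ℚ)` finite ⇒
`ord_{s=1} L(E,s) = 0`** — modulo the §4.6 tier and PUBLISHED facts by name (modularity `hmodE` gives the
newform, Sprung 2017 Thm 1.12 — PROVED, `thm112_exists_isSprungPair_holds` — a pair, the period unit `h3`,
GZK `hGZK`). Chain: Rohrlich colour `•`; binder ⇒ `ξ` with (K•) and `(ξ) = (L^•)`; (K•) with `Sel` finite ⇒
`ξ(0) ≠ 0` ⇒ `L^•(0) ≠ 0` ⇒ (P•, Sprung's table, a theorem) `[0]⁺_f ≠ 0` ⇒ `L(E,1) ≠ 0`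
(`entireLFunction_one_ne_zero_and_missingLowerBoundAt_of_chromaticDatum`). Compare the direct PRE binder
`FouquetWan2021.analyticRank_eq_zero_of_finite_selmer_of_cor53_OPEN`. CONDITIONAL; closes nothing.
[claim: FouquetWan2021, status: under-review] [cite: Sprung2012, Prop. 7.19 and Main Conj. 7.21 (p. 1505)]
[cite: Sprung2017, Thm. 1.12 and Cor. 4.11] [cite: GreenbergVatsal2000, §3 Remark 3.4] -/
theorem X8.analyticRank_eq_zero_fwLocus_of_thm451_OPEN_of_finite_selmer
    (hFW : FouquetWan2021_thm451_via_sprung719_OPEN) (hmodE : exists_isNewformOf)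
    (h3 : realPeriodRat_eq_unit_mul_plusPeriod_three) (hGZK : rank_eq_analyticRank_of_analyticRank_le_one)
    (hX : ClassX8 W p)
    (hloc : ∃ (ℓ : ℕ) (_ : Fact ℓ.Prime), ℓ ≠ p ∧ W.HasMultiplicativeReductionAtPrime ℓ ∧
        ¬ W.HasSplitMultiplicativeReductionAtPrime ℓ ∧ ¬ p ∣ padicValInt ℓ W.minimalDiscriminantInt)
    (hfin : Finite (W.selmerGroupPInfty p)) : W.analyticRank = 0 := by
  have hirr : Irr W p := ClassX8.irr' W p hX
  have hp3 : p = 3 := hX.1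
  subst hp3
  have hgood : W.HasGoodReductionAtPrime 3 := hX.2.1.1
  haveI hN : NeZero (W.conductorNorm ℤ) := ⟨(W.conductorNorm_pos_holds).ne'⟩
  obtain ⟨f, hf⟩ := hmodE W
  obtain ⟨u, hu1, hΩ⟩ := h3 W hgood hirr f hf
  have hu0 : u ≠ 0 := by
    intro h0
    rw [h0, Rat.cast_zero, norm_zero] at hu1
    exact zero_ne_one hu1
  have hϖ : ((u⁻¹ : ℚ) : ℝ) * W.realPeriodRat = plusPeriod f := by
    rw [hΩ, Rat.cast_inv, ← mul_assoc, inv_mul_cancel₀ (Rat.cast_ne_zero.mpr hu0), one_mul]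
  obtain ⟨Lsharp, Lflat, hSP⟩ :=
    thm112_exists_isSprungPair_holds (W := W) (f := f) (p := 3) (by decide) hf hgood hX.2.1.2
  obtain ⟨c, ξ, hK, h, -, hh⟩ := X8.chromaticDivisibility_fwLocus_of_thm451_OPEN W 3 hFW h3 hX hloc hf hϖ
    hSP
  exact analyticRank_eq_zero_of_entireLFunction_one_ne_zero W
    (entireLFunction_one_ne_zero_and_missingLowerBoundAt_of_chromaticDatum W 3 hGZK (by decide) hgood hirr hf
      hϖ hSP c (ClassX8.not_dvd_chromaticConst' W 3 hX c) hfin ξ hK ⟨h, hh⟩).1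

/-- **Cor 5.4's X8 content RECOVERED from the one binder: on X8 ∩ (FW locus) ∩ {r_an = 0}, Miller's
`BSD(E,3)`** — modulo the §4.6 tier and PUBLISHED facts by name (`hmodE`, `hmod`, `h3`, `hGZK`). In rank 0
both colours are non-zero (`ClassX8.chromaticL_ne_zero_of_analyticRank_eq_zero`); the binder gives `ξ` with
(K♭) and `(ξ) = (L♭)` — the EQUALITY — and `bsdp_iff_span_eq_span_chromaticL_of_analyticRank_eq_zero`
(Sprung's Main Conj 7.21 at the pair ⟺ `BSDp`, its displayed Kato divisibility read off the equality) turns it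
into `BSDp W 3`. Compare the direct PRE road `FouquetWan2021.bsdp_of_cor54_OPEN_of_analyticRank_eq_zero`.
CONDITIONAL; closes nothing; nothing booked. [claim: FouquetWan2021, status: under-review]
[cite: Sprung2012, Prop. 7.19 and Main Conj. 7.21 (p. 1505)] [cite: Sprung2024, Lemmas 5.5–5.9 (pp. 40–41)]
[cite: Sprung2017, Thm. 1.12 and Cor. 4.11] [cite: Miller2011LMS, Def. 1.1] -/
theorem X8.bsdp_fwLocus_of_thm451_OPEN_of_analyticRank_eq_zero
    (hFW : FouquetWan2021_thm451_via_sprung719_OPEN) (hmodE : exists_isNewformOf)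
    (hmod : hasEntireLFunction_rat) (h3 : realPeriodRat_eq_unit_mul_plusPeriod_three)
    (hGZK : rank_eq_analyticRank_of_analyticRank_le_one)
    (hX : ClassX8 W p)
    (hloc : ∃ (ℓ : ℕ) (_ : Fact ℓ.Prime), ℓ ≠ p ∧ W.HasMultiplicativeReductionAtPrime ℓ ∧
        ¬ W.HasSplitMultiplicativeReductionAtPrime ℓ ∧ ¬ p ∣ padicValInt ℓ W.minimalDiscriminantInt)
    (h0 : W.analyticRank = 0) : BSDp W p := by
  have hirr : Irr W p := ClassX8.irr' W p hX
  have hp3 : p = 3 := hX.1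
  subst hp3
  have hgood : W.HasGoodReductionAtPrime 3 := hX.2.1.1
  have hL : W.entireLFunction 1 ≠ 0 := (W.analyticRank_eq_zero_iff_holds (hmod W)).1 h0
  haveI hN : NeZero (W.conductorNorm ℤ) := ⟨(W.conductorNorm_pos_holds).ne'⟩
  obtain ⟨f, hf⟩ := hmodE W
  obtain ⟨Lsharp, Lflat, hSP⟩ :=
    thm112_exists_isSprungPair_holds (W := W) (f := f) (p := 3) (by decide) hf hgood hX.2.1.2
  have hc : chromaticL .flat Lsharp Lflat ≠ 0 :=
    ClassX8.chromaticL_ne_zero_of_analyticRank_eq_zero W 3 hX hf hSP h0 .flat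
  obtain ⟨ξ, hK, hspan⟩ := X8.sharpFlatMainConjecture_fwLocus_of_thm451_OPEN W 3 hFW hX hloc hf hSP .flat hc
  have hU : ξ ∣ chromaticL .flat Lsharp Lflat := by
    obtain ⟨v, hv⟩ := Ideal.span_singleton_eq_span_singleton.mp hspan
    exact ⟨v, hv.symm⟩
  exact (bsdp_iff_span_eq_span_chromaticL_of_analyticRank_eq_zero W 3 hGZK (by decide) hgood hirr hL hf
    (h3 W hgood hirr f hf) hSP .flat (ClassX8.not_dvd_chromaticConst' W 3 hX .flat) ξ hK hU).mpr hspan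

/-- **Typed-currency form: `X8.MissingInputAt W 3` on X8 ∩ (FW locus) ∩ {r_an = 0}** modulo the §4.6 tier
and the published facts (its image branch is immaterial: `BSDp` gives both `MissingLowerBoundAt` and
`MissingPPartAt`, with `Ш` finite by GZK). CONDITIONAL; closes nothing. [claim: FouquetWan2021, status: under-review]
[cite: Sprung2012, Prop. 7.19 and Main Conj. 7.21 (p. 1505)] [cite: Miller2011LMS, Def. 1.1] -/
theorem X8.missingInputAt_fwLocus_of_thm451_OPEN_of_analyticRank_eq_zero
    (hFW : FouquetWan2021_thm451_via_sprung719_OPEN) (hmodE : exists_isNewformOf)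
    (hmod : hasEntireLFunction_rat) (h3 : realPeriodRat_eq_unit_mul_plusPeriod_three)
    (hGZK : rank_eq_analyticRank_of_analyticRank_le_one)
    (hX : ClassX8 W p)
    (hloc : ∃ (ℓ : ℕ) (_ : Fact ℓ.Prime), ℓ ≠ p ∧ W.HasMultiplicativeReductionAtPrime ℓ ∧
        ¬ W.HasSplitMultiplicativeReductionAtPrime ℓ ∧ ¬ p ∣ padicValInt ℓ W.minimalDiscriminantInt)
    (h0 : W.analyticRank = 0) : X8.MissingInputAt W p := by
  have hB : BSDp W p :=
    X8.bsdp_fwLocus_of_thm451_OPEN_of_analyticRank_eq_zero W p hFW hmodE hmod h3 hGZK hX hloc h0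
  haveI : Finite W.sha := (hGZK W (by omega)).2
  have hPP : MissingPPartAt W p := missingPPartAt_of_bsdp W p hB
  exact ⟨fun _ _ ↦ (lower_and_upper_of_missingPPartAt W p hPP).1, fun _ ↦ hPP⟩

end Consumers

end Summit.BirchSwinnertonDyer.BirchSwinnertonDyer.Theorems

end
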